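import Summits.ResolutionOfSingularities.ResolutionOfSingularities.Theorems.HomologicalConductorNoZenoSplittingChoice
import Summits.ResolutionOfSingularities.ResolutionOfSingularities.Theorems.HomologicalConductorNoZenoSplitWeightFinite
import Summits.ResolutionOfSingularities.ResolutionOfSingularities.Theorems.HomologicalConductorNoZenoSplittingBaseNormal
import Summits.ResolutionOfSingularities.ResolutionOfSingularities.Theorems.HomologicalConductorNoZenoSplitData
import HarnessLib

/-!
# Crux `NoZenoR` (stmt-ResolutionOfSingularities-19943), β layer, slot 5 seam0 (F-out):
# the CHOICE of the thread polynomial `f` — one splitting field for finitely many points, realised by a one-root germ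

Route `ResolutionOfSingularities/HomologicalConductor`, crux chain W4.4.  OURS (cell res-hironaka; object (F-out) of the seam0
«UPSTAIRS TRANSFER PACKAGE» (res-L0-w44-lead-1 SPEC 2026-08-27T21:26:18Z, (U2w-set) 21:29:15Z; planner res-L0-w44-plan-1
DESK WORD 26), hand res-D-pv-039; consumer: the slot-5 closer glue).  Assembly BY NAME of res-L0-w44-stub-2's splitting
choice (`…NoZenoSplittingChoice.exists_splittingField`), res-D-pv-039's BC-0 (`…NoZenoSplittingBaseNormal.
exists_adjoinRoot_normal_splittingBase`) and one-root germ (`…NoZenoSplitData`: `irreducible_map_germ`, `isPrime_splitPrime`,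
`splitGermAlgEquiv`, `isLocalHom_germ`), and res-L1-type-o5's finite weights (`…NoZenoSplitWeightFinite`); AI-written,
weaker than expert review; nothing here is a statement of the manuscript under review (Hironaka 2017); no Theses file is
imported.  Def-free, fact-free, `--supports 19943 --as helper`.

* `splits_separableClosure_of_algHom` — field bookkeeping: a splitting clause for the separable closure of `κ₀` in `F'`
  gives it for the separable closure of `κ₀` in any `κ₀`-subfield `F → F'`;
* **`splits_clause_of_comp`** — TRANSPORT DOWN A LIFT: for `ρ : X¹ → X` over `π : X → Spec D` and `η¹ ∈ X¹`, the
  splitting clause of `exists_splittingField` at `η¹` for `ρ ≫ π` implies the clause at `ρ η¹` for `π` (through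
  `κ(ρ η¹) → κ(η¹)`; no bijectivity needed) — so ONE call on `π¹ := ρ ≫ π` with a set containing the lifts of the old
  curves serves BOTH the (U2w) clause downstairs (`upstairs_count_le`'s `hsplit`, `…NoZenoUpstairsCount`) and the (S2a)
  clause at the finitely many node points upstairs (leadʼs (U2w-set));
* **`exists_splitting_threadPoly`** — (F-out): for `D ⊆ K` a local Noetherian normal `k`-subalgebra with `Frac D = K`,
  `π¹ : X¹ → Spec D` locally of finite type and a FINITE set `S` of points of its closed fibre, there is a monic
  `f ∈ D[X]` with `f̄` irreducible separable, `f_K` irreducible, `P_f` prime, such that the residue field of the one-root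
  germ `D_f = locPrime (splitModel D f) (splitPrime D f)` SPLITS the separable constant field `κ(y)^s` of every `y ∈ S`
  — in `exists_splittingField`'s literal output shape at `B := D_f` (= the `hsplit` binders of BC-2c /
  `upstairs_count_le` / (S2a)).

References: J. Lipman, Publ. Math. IHÉS 36 (1969) §16 (16.1) p. 231 (base change to a larger residue field; context)
[`Lipman1969`].
-/

noncomputable section

-- single-problem summit: the doubled namespace component `ResolutionOfSingularities` is forced
set_option linter.dupNamespace false

namespace Summit.ResolutionOfSingularities.ResolutionOfSingularities.Theorems.NoZeno.ExcCount

open CategoryTheory AlgebraicGeometry IsLocalRing Polynomial IntermediateField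
open Summit.ResolutionOfSingularities.ResolutionOfSingularities.Theorems.NoZeno.SandwichCluster
open Parasite (locPrime isLocalRing_locPrime)
open Summit.ResolutionOfSingularities.ResolutionOfSingularities.Theorems.NoZeno.SplittingBase

/-! ## §1 Transport of the splitting clause along a `κ₀`-algebra map -/

section Transport

/-- **Field bookkeeping.**  `κ₀`-algebras `F → F'` (fields) and a `κ₀`-algebra `Ω`: if the minimal polynomial over `κ₀` of
every element of the separable closure of `κ₀` in `F'` splits in `Ω`, so does that of every element of the separable
closure of `κ₀` in `F` (an injective `κ₀`-algebra map preserves separable elements and minimal polynomials). [folklore] -/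
theorem splits_separableClosure_of_algHom {κ₀ F F' Ω : Type*} [Field κ₀] [Field F] [Field F'] [Field Ω]
    [Algebra κ₀ F] [Algebra κ₀ F'] [Algebra κ₀ Ω] (e : F →ₐ[κ₀] F')
    (h : ∀ x : separableClosure κ₀ F', ((minpoly κ₀ x).map (algebraMap κ₀ Ω)).Splits)
    (x : separableClosure κ₀ F) : ((minpoly κ₀ x).map (algebraMap κ₀ Ω)).Splits := by
  have hx1 : e x ∈ separableClosure κ₀ F' := (map_mem_separableClosure_iff e).2 x.2
  have h1 := h ⟨e x, hx1⟩
  have hmin : minpoly κ₀ (⟨e x, hx1⟩ : separableClosure κ₀ F') = minpoly κ₀ x := by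
    rw [← minpoly.algHom_eq (separableClosure κ₀ F').val Subtype.val_injective ⟨e x, hx1⟩,
      ← minpoly.algHom_eq (separableClosure κ₀ F).val Subtype.val_injective x]
    exact minpoly.algHom_eq e e.injective (x : F)
  rw [hmin] at h1
  exact h1

variable {D : Type} [CommRing D] {B : Type} [CommRing B] [IsLocalRing B] [Algebra D B]
  {X X1 : Scheme.{0}} (π : X ⟶ Spec (.of D)) (ρ : X1 ⟶ X) (η1 : X1)

/-- **Transport of the splitting clause down a lift.**  For `ρ : X¹ → X` over `π : X → Spec D`, a local `D`-algebra `B`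
with `g := Spec (D → B)` mapping its closed point to `π (ρ η¹)`, and `η¹ ∈ X¹`: the clause «`κ(𝔪_B)` splits the separable
closure of `κ(π (ρ η¹))` in `κ(η¹)`» (output of `exists_splittingField` for `ρ ≫ π` at `η¹`) implies the same clause for
`κ(ρ η¹)` (the `hsplit` input of BC-2c / `upstairs_count_le` at `ρ η¹`), through the `κ(π (ρ η¹))`-algebra map
`κ(ρ η¹) → κ(η¹)` (`Scheme.Hom.residueFieldMap_comp`). [this work] -/
theorem splits_clause_of_comp
    (hy : (Spec.map (CommRingCat.ofHom (algebraMap D B))).base (closedPoint B) = π.base (ρ.base η1))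
    (h : letI := ((ρ ≫ π).residueFieldMap η1).hom.toAlgebra
      letI := (((Spec (.of D)).residueFieldCongr
          (show (Spec.map (CommRingCat.ofHom (algebraMap D B))).base (closedPoint B) = (ρ ≫ π).base η1
            from hy)).inv ≫
        (Spec.map (CommRingCat.ofHom (algebraMap D B))).residueFieldMap (closedPoint B)).hom.toAlgebra
      ∀ x : separableClosure ((Spec (.of D)).residueField ((ρ ≫ π).base η1)) (X1.residueField η1),
        ((minpoly ((Spec (.of D)).residueField ((ρ ≫ π).base η1)) x).map
          (algebraMap ((Spec (.of D)).residueField ((ρ ≫ π).base η1))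
            ((Spec (.of B)).residueField (closedPoint B)))).Splits) :
    letI := (π.residueFieldMap (ρ.base η1)).hom.toAlgebra
    letI := (((Spec (.of D)).residueFieldCongr hy).inv ≫
      (Spec.map (CommRingCat.ofHom (algebraMap D B))).residueFieldMap (closedPoint B)).hom.toAlgebra
    ∀ x : separableClosure ((Spec (.of D)).residueField (π.base (ρ.base η1))) (X.residueField (ρ.base η1)),
      ((minpoly ((Spec (.of D)).residueField (π.base (ρ.base η1))) x).map
        (algebraMap ((Spec (.of D)).residueField (π.base (ρ.base η1)))
          ((Spec (.of B)).residueField (closedPoint B)))).Splits := by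
  letI algF : Algebra ((Spec (.of D)).residueField (π.base (ρ.base η1))) (X.residueField (ρ.base η1)) :=
    (π.residueFieldMap (ρ.base η1)).hom.toAlgebra
  letI algF' : Algebra ((Spec (.of D)).residueField (π.base (ρ.base η1))) (X1.residueField η1) :=
    ((ρ ≫ π).residueFieldMap η1).hom.toAlgebra
  letI algΩ : Algebra ((Spec (.of D)).residueField (π.base (ρ.base η1)))
      ((Spec (.of B)).residueField (closedPoint B)) :=
    (((Spec (.of D)).residueFieldCongr hy).inv ≫
      (Spec.map (CommRingCat.ofHom (algebraMap D B))).residueFieldMap (closedPoint B)).hom.toAlgebra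
  -- `κ(ρ η¹) → κ(η¹)` is a `κ(π (ρ η¹))`-algebra map
  let e : X.residueField (ρ.base η1) →ₐ[(Spec (.of D)).residueField (π.base (ρ.base η1))] X1.residueField η1 :=
    { (ρ.residueFieldMap η1).hom with
      commutes' := fun a => by
        change (ρ.residueFieldMap η1).hom ((π.residueFieldMap (ρ.base η1)).hom a) =
          ((ρ ≫ π).residueFieldMap η1).hom a
        rw [Scheme.residueFieldMap_comp]
        rfl }
  intro x
  exact splits_separableClosure_of_algHom e h x

end Transport

/-! ## §2 (F-out): the thread polynomial splitting finitely many points -/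

section Choice

variable {k K : Type} [Field k] [Field K] [Algebra k K]

/-- **(F-out) The thread polynomial `f`, chosen to split finitely many separable constant fields.**  For a local
Noetherian normal `k`-subalgebra `D ⊆ K` with `Frac D = K`, `π¹ : X¹ → Spec D` locally of finite type and a finite set
`S` of points of the closed fibre of `π¹`: there is a monic `f ∈ D[X]` with irreducible separable reduction `f̄`,
`f_K` irreducible (so `K_f` is a field) and `P_f` prime, such that — with `D_f := locPrime (splitModel D f) (splitPrime D f)`
the one-root germ, a local `D`-algebra (`germAlgebra`, `isLocalHom_germ`) — for every `y ∈ S` and every identification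
`hy` of `g 𝔪_{D_f}` with `π¹ y` (`g = Spec (D → D_f)`; e.g. `specMap_closedPoint`), the residue field `κ(𝔪_{D_f})` splits the
minimal polynomial over `κ(π¹ y)` of every element of `separableClosure κ(π¹ y) κ(y)` — `exists_splittingField`'s output
(res-L0-w44-stub-2) realised by BC-0's normal splitting base with prescribed residue field `κ₁` and the isomorphism
`κ(D_f) ≃ κ(D[X]/(f)) ≃ κ₁` (`splitGermAlgEquiv`). [this work] -/
theorem exists_splitting_threadPoly (D : Subalgebra k K) [IsLocalRing ↥D] [IsNoetherianRing ↥D]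
    [IsIntegrallyClosed ↥D] [IsFractionRing ↥D K]
    {X1 : Scheme.{0}} (π1 : X1 ⟶ Spec (.of ↥D)) [LocallyOfFiniteType π1]
    (S : Set X1) (hS : S.Finite) (hSπ : ∀ y ∈ S, π1.base y = closedPoint ↥D) :
    ∃ (f : (↥D)[X]) (hf : f.Monic) (hirr : Irreducible (f.map (residue ↥D)))
      (_ : (f.map (residue ↥D)).Separable) (_ : Fact (Irreducible (f.map (algebraMap ↥D K))))
      (hPf : (splitPrime D f).IsPrime),
      haveI := isLocalHom_germ D f hf hirr hPf
      ∀ (y : X1) (_ : y ∈ S)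
        (hy : (Spec.map (CommRingCat.ofHom (algebraMap ↥D
          ↥(locPrime (splitModel D f) (splitPrime D f) hPf)))).base
            (closedPoint ↥(locPrime (splitModel D f) (splitPrime D f) hPf)) = π1.base y),
        letI := (π1.residueFieldMap y).hom.toAlgebra
        letI := (((Spec (.of ↥D)).residueFieldCongr hy).inv ≫
          (Spec.map (CommRingCat.ofHom (algebraMap ↥D
            ↥(locPrime (splitModel D f) (splitPrime D f) hPf)))).residueFieldMap
            (closedPoint ↥(locPrime (splitModel D f) (splitPrime D f) hPf))).hom.toAlgebra
        ∀ x : separableClosure ((Spec (.of ↥D)).residueField (π1.base y)) (X1.residueField y),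
          ((minpoly ((Spec (.of ↥D)).residueField (π1.base y)) x).map
            (algebraMap ((Spec (.of ↥D)).residueField (π1.base y))
              ((Spec (.of ↥(locPrime (splitModel D f) (splitPrime D f) hPf))).residueField
                (closedPoint ↥(locPrime (splitModel D f) (splitPrime D f) hPf))))).Splits := by
  classical
  -- finite (honest) weights at the points of `S`
  have hFW : ∀ y ∈ S, letI := (π1.residueFieldMap y).hom.toAlgebra
      FiniteDimensional ((Spec (.of ↥D)).residueField (π1.base y))
        (separableClosure ((Spec (.of ↥D)).residueField (π1.base y)) (X1.residueField y)) :=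
    fun y _ => finiteDimensional_separableClosure_residueField π1 y
  -- the splitting residue field `κ₁`
  obtain ⟨κ₁, hfin₁, hsep₁, hclause⟩ := exists_splittingField π1 S hS hSπ hFW
  letI instAlgκ₁ : Algebra (ResidueField ↥D) ↥κ₁ := κ₁.algebra'
  haveI := hfin₁
  haveI := hsep₁
  -- BC-0: a normal one-root splitting base with residue field `κ₁`
  obtain ⟨f, hf, -, hirr, hsep, -, -, hlocB, hlhB, -, -, -, -, -, ⟨eB⟩⟩ :=
    exists_adjoinRoot_normal_splittingBase (↥D) (↥κ₁)
  haveI : Fact (Irreducible (f.map (algebraMap ↥D K))) := ⟨irreducible_map_germ D f hf hirr⟩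
  have hPf : (splitPrime D f).IsPrime := isPrime_splitPrime D f hf hirr
  haveI := isLocalHom_germ D f hf hirr hPf
  -- `κ(D_f) ≃ₐ[κ(D)] κ(D[X]/(f)) ≃ₐ[κ(D)] κ₁`
  let E₀ : ResidueField ↥(locPrime (splitModel D f) (splitPrime D f) hPf) ≃ₐ[↥D] ResidueField (AdjoinRoot f) :=
    (IsLocalRing.ResidueField.mapAlgEquiv (splitGermAlgEquiv D f hf hirr hPf)).symm
  let E₁ : ResidueField ↥(locPrime (splitModel D f) (splitPrime D f) hPf) ≃ₐ[ResidueField ↥D]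
      ResidueField (AdjoinRoot f) :=
    AlgEquiv.extendScalarsOfSurjective residue_surjective E₀
  let e : ResidueField ↥(locPrime (splitModel D f) (splitPrime D f) hPf) ≃ₐ[ResidueField ↥D] ↥κ₁ := E₁.trans eB
  refine ⟨f, hf, hirr, hsep, inferInstance, hPf, ?_⟩
  intro y hyS hy
  exact hclause _ e y hyS hy

end Choice

end Summit.ResolutionOfSingularities.ResolutionOfSingularities.Theorems.NoZeno.ExcCount

end
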